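import Literature.NumberTheory.EllipticCurves.WeierstrassAddLawsComplete
import Literature.NumberTheory.EllipticCurves.AbelianVarietyModelOfAddHom
import HarnessLib

/-!
# The two addition laws on `L`-points of the Weierstrass cubic

Field-level dictionary between Mathlib's projective addition formulas and the points of the scheme
`E_W` (`WeierstrassCurve.scheme`), for an elliptic curve `W` over `K` and a field `L ⊇ K`:

* `pointEquiv_toAffine`, `pointEquiv_symm_schemePoint`: under `W.pointEquiv : W(L) ≃ E_W(L)` the
  point `[v]` with nonsingular homogeneous coordinates `v` is Mathlib's `Projective.Point.toAffine v`
  (Silverman, *AEC* III.2: `[x : y : 1] ↔ (x, y)`, `[0 : 1 : 0] ↔ O`);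
* `pointEquiv_symm_schemePoint_add`: `[W.add P Q] = [P] + [Q]` in `W(L)` (Mathlib `toAffine_add`);
* hence for **Mathlib's law** `addXYZ` (bidegree `(2,2)`) and the **second law** `add₂XYZ` of
  `EllipticCurves/WeierstrassAddLawTwo` (Bosma–Lenstra): wherever the law is non-zero at nonsingular
  `P, Q`, its value satisfies the Weierstrass equation and `[law P Q] = [P] + [Q]`
  (`equation_addXYZ`, `equation_add₂XYZ`, `pointEquiv_symm_schemePoint_addXYZ`,
  `pointEquiv_symm_schemePoint_add₂XYZ`, using `addXYZ_eq_add` / `add₂XYZ_equiv_add` of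
  `EllipticCurves/WeierstrassAddLawsComplete`), and the same on geometric points in the additive
  group `W.geomPoints` (`toGeomPoint_schemePoint_addXYZ`, `toGeomPoint_schemePoint_add₂XYZ`).

These are the pointwise inputs for the law charts of the addition morphism `E_W × E_W → E_W`
(`EllipticCurves/WeierstrassAddAtlas`; Silverman, *AEC* III.3.6).

## References

* J. H. Silverman, *The Arithmetic of Elliptic Curves*, 2nd ed. (2009): III.2, III.3.6. [SilvermanAEC2009]
* W. Bosma, H. W. Lenstra, J. Number Theory 53 (1995), 229–240: Theorem 2. [BosmaLenstra1995]
-/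

noncomputable section

open CategoryTheory AlgebraicGeometry
open Literature.AlgebraicGeometry.Motives Literature.NumberTheory.EllipticCurves
open scoped Classical

universe u

namespace WeierstrassCurve

variable {K : Type u} [Field K] (W : WeierstrassCurve K) [W.IsElliptic]
  {L : Type u} [Field L] [Algebra K L]

/-! ### `pointEquiv` and homogeneous coordinates -/

/-- **`pointEquiv (toAffine v) = [v]`** for nonsingular homogeneous coordinates `v`
(Silverman, *AEC* III.2). [cite: SilvermanAEC2009, III.2] -/
theorem pointEquiv_toAffine (v : Fin 3 → L) (hv : (W.baseChange L).toProjective.Nonsingular v) :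
    W.pointEquiv (Projective.Point.toAffine (W.baseChange L).toProjective v) =
      W.schemePoint v hv.ne_zero hv.1 := by
  have hl : (W.baseChange L).toProjective.NonsingularLift ⟦v⟧ :=
    (Projective.nonsingularLift_iff v).mpr hv
  change W.schemePointOfPoint (Projective.Point.fromAffine
    (Projective.Point.toAffine (W.baseChange L).toProjective v)) = _
  have e : Projective.Point.fromAffine (Projective.Point.toAffine (W.baseChange L).toProjective v) =
      ⟨hl⟩ :=
    (Projective.Point.toAffineAddEquiv (W.baseChange L).toProjective).symm_apply_apply ⟨hl⟩
  rw [e, schemePointOfPoint_mk]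

/-- **`pointEquiv⁻¹ [v] = toAffine v`.** [cite: SilvermanAEC2009, III.2] -/
theorem pointEquiv_symm_schemePoint (v : Fin 3 → L) (hv : (W.baseChange L).toProjective.Nonsingular v)
    (hv0 : v ≠ 0) (hEq : (W.baseChange L).toProjective.Equation v) :
    W.pointEquiv.symm (W.schemePoint v hv0 hEq) =
      Projective.Point.toAffine (W.baseChange L).toProjective v :=
  W.pointEquiv.symm_apply_eq.mpr (W.pointEquiv_toAffine v hv).symm

/-- Every solution of the Weierstrass equation of an elliptic curve is nonsingular (field points).
[cite: SilvermanAEC2009, III.1 Prop. 1.4(a)] -/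
theorem nonsingular_of_equation' {v : Fin 3 → L} (hv0 : v ≠ 0)
    (hEq : (W.baseChange L).toProjective.Equation v) : (W.baseChange L).toProjective.Nonsingular v :=
  haveI : (W.baseChange L).toProjective.IsElliptic := inferInstanceAs ((W.map (algebraMap K L)).IsElliptic)
  Projective.nonsingular_of_equation hv0 hEq

/-- **`[W.add P Q] = [P] + [Q]` in `W(L)`** for nonsingular representatives (Mathlib `toAffine_add`;
Silverman, *AEC* III.2). [cite: SilvermanAEC2009, III.2] -/
theorem pointEquiv_symm_schemePoint_add {P Q : Fin 3 → L}
    (hP : (W.baseChange L).toProjective.Nonsingular P) (hQ : (W.baseChange L).toProjective.Nonsingular Q)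
    (hP0 : P ≠ 0) (hPe : (W.baseChange L).toProjective.Equation P)
    (hQ0 : Q ≠ 0) (hQe : (W.baseChange L).toProjective.Equation Q)
    (h0 : (W.baseChange L).toProjective.add P Q ≠ 0)
    (he : (W.baseChange L).toProjective.Equation ((W.baseChange L).toProjective.add P Q)) :
    W.pointEquiv.symm (W.schemePoint ((W.baseChange L).toProjective.add P Q) h0 he) =
      W.pointEquiv.symm (W.schemePoint P hP0 hPe) + W.pointEquiv.symm (W.schemePoint Q hQ0 hQe) := by
  rw [W.pointEquiv_symm_schemePoint _ (Projective.nonsingular_add hP hQ), W.pointEquiv_symm_schemePoint P hP,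
    W.pointEquiv_symm_schemePoint Q hQ, Projective.Point.toAffine_add hP hQ]

/-! ### The two laws -/

section Laws

variable {F : Type u} [Field F] {V : WeierstrassCurve F}

omit [W.IsElliptic] in
/-- The zero vector satisfies every homogeneous Weierstrass equation. [folklore] -/
theorem equation_zero_vec : V.toProjective.Equation (0 : Fin 3 → F) := by
  rw [Projective.equation_iff]
  simp

omit [W.IsElliptic] in
/-- **Mathlib's law lands on the curve**: `F(addXYZ P Q) = 0` for nonsingular `P, Q` (it is `0` if
`P ≈ Q`, and Mathlib's representative `W.add P Q` of `P + Q` otherwise). [folklore] -/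
theorem equation_addXYZ {P Q : Fin 3 → F} (hP : V.toProjective.Nonsingular P)
    (hQ : V.toProjective.Nonsingular Q) : V.toProjective.Equation (V.toProjective.addXYZ P Q) := by
  by_cases h : V.toProjective.addXYZ P Q = 0
  · rw [h]; exact equation_zero_vec
  · rw [Projective.addXYZ_eq_add h]
    exact (Projective.nonsingular_add hP hQ).1

omit [W.IsElliptic] in
/-- **The second law lands on the curve**: `F(add₂XYZ P Q) = 0` for nonsingular `P, Q` (it is `0` or a
unit multiple of `W.add P Q`). [cite: BosmaLenstra1995, Theorem 2] -/
theorem equation_add₂XYZ {P Q : Fin 3 → F} (hP : V.toProjective.Nonsingular P)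
    (hQ : V.toProjective.Nonsingular Q) : V.toProjective.Equation (V.toProjective.add₂XYZ P Q) := by
  by_cases h : V.toProjective.add₂XYZ P Q = 0
  · rw [h]; exact equation_zero_vec
  · exact (Projective.equation_of_equiv (Projective.add₂XYZ_equiv_add hP hQ h)).mpr
      (Projective.nonsingular_add hP hQ).1

end Laws

/-- **`[addXYZ P Q] = [P] + [Q]`** wherever Mathlib's law is non-zero. [cite: SilvermanAEC2009, III.3.6] -/
theorem pointEquiv_symm_schemePoint_addXYZ {P Q : Fin 3 → L}
    (hP0 : P ≠ 0) (hPe : (W.baseChange L).toProjective.Equation P)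
    (hQ0 : Q ≠ 0) (hQe : (W.baseChange L).toProjective.Equation Q)
    (h0 : (W.baseChange L).toProjective.addXYZ P Q ≠ 0)
    (he : (W.baseChange L).toProjective.Equation ((W.baseChange L).toProjective.addXYZ P Q)) :
    W.pointEquiv.symm (W.schemePoint ((W.baseChange L).toProjective.addXYZ P Q) h0 he) =
      W.pointEquiv.symm (W.schemePoint P hP0 hPe) + W.pointEquiv.symm (W.schemePoint Q hQ0 hQe) := by
  have hP := W.nonsingular_of_equation' hP0 hPe
  have hQ := W.nonsingular_of_equation' hQ0 hQe
  have h0' : (W.baseChange L).toProjective.add P Q ≠ 0 := by rwa [← Projective.addXYZ_eq_add h0]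
  rw [← W.pointEquiv_symm_schemePoint_add hP hQ hP0 hPe hQ0 hQe h0' (by rwa [← Projective.addXYZ_eq_add h0])]
  congr 1
  exact (W.schemePoint_eq_schemePoint_iff _ _ _ _ _ _).mpr
    ⟨1, one_ne_zero, by rw [one_smul]; exact (Projective.addXYZ_eq_add h0).symm⟩

/-- **`[add₂XYZ P Q] = [P] + [Q]`** wherever the second law is non-zero. [cite: BosmaLenstra1995, Theorem 2] -/
theorem pointEquiv_symm_schemePoint_add₂XYZ {P Q : Fin 3 → L}
    (hP0 : P ≠ 0) (hPe : (W.baseChange L).toProjective.Equation P)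
    (hQ0 : Q ≠ 0) (hQe : (W.baseChange L).toProjective.Equation Q)
    (h0 : (W.baseChange L).toProjective.add₂XYZ P Q ≠ 0)
    (he : (W.baseChange L).toProjective.Equation ((W.baseChange L).toProjective.add₂XYZ P Q)) :
    W.pointEquiv.symm (W.schemePoint ((W.baseChange L).toProjective.add₂XYZ P Q) h0 he) =
      W.pointEquiv.symm (W.schemePoint P hP0 hPe) + W.pointEquiv.symm (W.schemePoint Q hQ0 hQe) := by
  have hP := W.nonsingular_of_equation' hP0 hPe
  have hQ := W.nonsingular_of_equation' hQ0 hQe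
  have hns := Projective.nonsingular_add hP hQ
  rw [← W.pointEquiv_symm_schemePoint_add hP hQ hP0 hPe hQ0 hQe hns.ne_zero hns.1]
  congr 1
  exact W.schemePoint_eq_of_equiv (Projective.add₂XYZ_equiv_add hP hQ h0) _ _ _ _

/-! ### On geometric points -/

section Geom

/-- **`[addXYZ P Q] = [P] + [Q]` in the `Γ_K`-module `W.geomPoints`** (the form used by the law
charts of `EllipticCurves/WeierstrassAddAtlas`). [cite: SilvermanAEC2009, III.3.6] -/
theorem toGeomPoint_schemePoint_addXYZ {P Q : Fin 3 → (AlgebraicClosure K)}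
    (hP0 : P ≠ 0) (hPe : (W.baseChange (AlgebraicClosure K)).toProjective.Equation P)
    (hQ0 : Q ≠ 0) (hQe : (W.baseChange (AlgebraicClosure K)).toProjective.Equation Q)
    (h0 : (W.baseChange (AlgebraicClosure K)).toProjective.addXYZ P Q ≠ 0)
    (he : (W.baseChange (AlgebraicClosure K)).toProjective.Equation ((W.baseChange (AlgebraicClosure K)).toProjective.addXYZ P Q)) :
    W.toGeomPoint (W.schemePoint ((W.baseChange (AlgebraicClosure K)).toProjective.addXYZ P Q) h0 he) =
      W.toGeomPoint (W.schemePoint P hP0 hPe) + W.toGeomPoint (W.schemePoint Q hQ0 hQe) :=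
  W.pointEquiv_symm_schemePoint_addXYZ hP0 hPe hQ0 hQe h0 he

/-- **`[add₂XYZ P Q] = [P] + [Q]` in `W.geomPoints`.** [cite: BosmaLenstra1995, Theorem 2] -/
theorem toGeomPoint_schemePoint_add₂XYZ {P Q : Fin 3 → (AlgebraicClosure K)}
    (hP0 : P ≠ 0) (hPe : (W.baseChange (AlgebraicClosure K)).toProjective.Equation P)
    (hQ0 : Q ≠ 0) (hQe : (W.baseChange (AlgebraicClosure K)).toProjective.Equation Q)
    (h0 : (W.baseChange (AlgebraicClosure K)).toProjective.add₂XYZ P Q ≠ 0)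
    (he : (W.baseChange (AlgebraicClosure K)).toProjective.Equation ((W.baseChange (AlgebraicClosure K)).toProjective.add₂XYZ P Q)) :
    W.toGeomPoint (W.schemePoint ((W.baseChange (AlgebraicClosure K)).toProjective.add₂XYZ P Q) h0 he) =
      W.toGeomPoint (W.schemePoint P hP0 hPe) + W.toGeomPoint (W.schemePoint Q hQ0 hQe) :=
  W.pointEquiv_symm_schemePoint_add₂XYZ hP0 hPe hQ0 hQe h0 he

end Geom

end WeierstrassCurve
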